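import Summits.BirchSwinnertonDyer.Rank1Residual.Additive.QuadraticBranchLowerDescentSemistable
import Summits.BirchSwinnertonDyer.Rank1Residual.Additive.ChiBranchLowerTransportPotMult
import Summits.BirchSwinnertonDyer.Rank1Residual.Additive.ChiBranchLowerTransportGord
import Summits.BirchSwinnertonDyer.Rank1Residual.Additive.X4RankZeroCoveredLocusNoLemma20
import Summits.BirchSwinnertonDyer.Rank1Residual.Additive.SemistableTwistTowerThree
import Summits.BirchSwinnertonDyer.Rank1Residual.Additive.GordThreeCycLowerCore
import HarnessLib

/-!
# X4 ∧ `r = 0` on the semistable-twist locus, END TO END: OUR `E♭`-level Λ-adic conjecture on the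
# quadratic branch ⟹ the LOWER half of `BSD(E,p)` — and, with the printed upper chain, `BSD(E,p)` —
# at EVERY odd `p`, both parities in ONE statement (cell `b2b-bsdres`, team n1011, seat p07 (gen 2),
# row T-N10-low NEXT (a); sequel of seat p10's `QuadraticBranchLowerDescentSemistable.lean` and of this
# seat's `ChiBranchLowerTransportPotMult.lean` / `ChiBranchLowerTransportGord.lean`)

HONEST FRAMING (cell `b2b-bsdres`, run/shared/lean/b2b/bsd-rank1-residual/, verbatim in every
file): the goal of the cell is to DELETE the COMBINATION-SHAPED residual classes of the
Birch–Swinnerton-Dyer formula for ALL analytic-rank `≤ 1` elliptic curves over `ℚ` — "full BSD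
formula for every rank `≤ 1` curve in class `C`" assembled STRICTLY from published theorems — so
that the rank-`≤ 1` remainder becomes exactly the CONSTRUCTION-SHAPED classes, which are TYPED
(missing-input `Prop`s), NOT attempted. This is not "finishing BSD". Team n1011 (RESIDUAL-MAP §I
N10 / N11): prove what is provable now; shrink each hard class to its core with data; no claim
beyond stated classes. Research route on the CONSTRUCTION-SHAPED items N10 (X4 part) and the (M) /
(G-ord)@3 shares of N11's LOWER clause; both stay CONSTRUCTION; nothing is booked; no label moves.
Theorems only — compositions of landed kernel theorems with OUR conjecture
`Additive.QuadraticBranchLowerDivisibilityAt` (seat p10, `@[conjecture] def`, NOT in print, nothing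
asserted) taken as an explicit hypothesis; no definition, no new named fact.

## What this file proves

The team's typed LOWER input of record on the semistable-twist locus of X4 is, at the deepest
(Λ-adic, `E♭`-) level, OUR conjecture `QuadraticBranchLowerDivisibilityAt V p` — the Skinner–Urban
containment `ϖ·L_p(E♭, ω^{(p−1)/2}, T) ∣ char_Λ e_{(p−1)/2} X(E♭/ℚ(μ_{p^∞}))` for the semistable twist
`V = E♭`, `C • V^{(p*)} = E`, `p* = (−1)^{(p−1)/2} p` (seat p10, `QuadraticBranchLower.lean`). Seat p10
descended it to this seat's `W`-level `T = 0` branch inputs for EVERY semistable twist datum, good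
ordinary OR multiplicative, both parities (`chiBranchLowerLeadingTerm[Odd]At_of_quadraticBranchLower`,
`QuadraticBranchLowerDescentSemistable.lean`); this seat transported those to Miller's currency
(`ClassX4M.missingLowerBoundAt_rankZero_of_chiBranchLower[Odd]`, Birch + Pal + the exact Delbourgo
1998 Prop. 4 (M) via n1011-p18; `ClassX4Gord.…_of_exact`). Composing, with the parity split
DISCHARGED inside the proof (`p ≠ 2` is part of `ClassX4`; `p ≡ 1 (mod 4)` runs the even branch with
Pal's `hPal`, `p ≡ 3 (mod 4)` — `p = 3` included — the odd branch, Pal for `d < 0` being a tree theorem):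

* §1 **X4(M) ∧ `r_an = 0`, every odd `p`**: `ClassX4M.missingLowerBoundAt_rankZero_of_quadraticBranchLower`
  — (∀ twist models `V` of `W`, `QuadraticBranchLowerDivisibilityAt V p`) ⟹ `Typed.MissingLowerBoundAt W p`;
  with surj(p) and the printed UPPER chain read WITHOUT the Wuthrich-Lemma-20 binder (n1011-p14's
  `ClassX4M.…_noL20`: Kato on the `ω^{(p−1)/2}`-component `hKato`, Delbourgo Prop. 4 `hDel`):
  `ClassX4M.x4MissingInputAt_rankZero_of_surj_of_quadraticBranchLower` (`Typed.X4.MissingInputAt W p`)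
  and `ClassX4M.bsdp_rankZero_of_surj_of_quadraticBranchLower` (`BSDp W p`). So on X4(M) ∧ surj ∧
  `r = 0` (the (M) rows are 82 103 of the 117 893 N11 cells at `p = 3`) `BSD(E,p)` follows from OUR
  ONE Λ-adic conjecture on `E♭` by modus ponens through the kernel, granted the cited upper chain.
* §2 **X4♯(G-ord) ∩ `I₀*` (`e = 2`) ∧ `r_an = 0`, every odd `p`, GIVEN the exact algebraic leading
  term `ExactLeadingTermAt W p`** (n1011-p18's typed second input on (G-ord)):
  `ClassX4Gord.missingLowerBoundAt_rankZero_of_quadraticBranchLower_of_exact`, and with surj(p) + Kato's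
  branch-component reading `hK` (certificate-free tower, n1011-p14):
  `ClassX4Gord.x4MissingInputAt_rankZero_of_surj_of_quadraticBranchLower_of_exact`,
  `ClassX4Gord.bsdp_rankZero_of_surj_of_quadraticBranchLower_of_exact`.
* §3 **(G-ord)@3 — X4♯(G-ord) at `p = 3` (defect `2` automatic), `r_an = 0`, non-CM — with the
  exact-leading-term input REPLACED by Delbourgo 2002 at `3`** (`hDel3 : Delbourgo2002.mainTheorem_three`,
  n1011-p16's `GordThreeCycLowerCore.lean`): OFF the anomalous rows
  `ClassX4Gord.missingLowerBoundAt_three_rankZero_of_quadraticBranchLower_of_nonAnomalous` and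
  `ClassX4Gord.bsdp_three_rankZero_of_surj_of_quadraticBranchLower_of_nonAnomalous`; on EVERY (G-ord)@3
  row the slack form `ClassX4Gord.padicValRat_shaAn_le_add_two_three_of_quadraticBranchLower`
  (`ord₃ #Ш_an ≤ ord₃ #Ш + 2`).

What is NOT claimed: the conjecture is OPEN on every pair (Skinner–Urban 2014 Thm. 3.6.4 is printed
for the trivial component under `p ∤ N` only; Burungale–Skinner–Tian–Wan arXiv:2409.01350 announce
`p ∤ 6N_g`, excluding a multiplicative `p` and `p = 3`); the X3 twins are n1011-p12's
(`X3BranchLowerDescent.lean`, via `X3BranchMainConjectureAt`); nothing here is a Literature fact.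
Labels UNCHANGED; nothing booked.

References: Skinner–Urban 2014 [SkinnerUrban2014] Thm. 3.6.4 and Remarks (i) p. 43 (shape only);
Mazur–Tate–Teitelbaum 1986 [MazurTateTeitelbaum1986Invent] §I.10, §I.13–I.14; Greenberg 1999
[GreenbergLNM1716] §5; Delbourgo 1998 [Delbourgo1998] §2.2 Lemma (ii), Prop. 4, Main Conjecture
p. 151; Delbourgo 2002 [Delbourgo2002] Theorem (A), (B); Kato 2004 [Kato2004Asterisque] Thm. 17.4 (3);
Wuthrich 2014 [Wuthrich2014] Cor. 19, Thm. 16; Pal 2012 [Pal2012] Thm. 3.2; Miller 2011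
[Miller2011LMS] Def. 1.1.
-/

noncomputable section

open scoped Classical MatrixGroups ModularForm NumberField

open CongruenceSubgroup WeierstrassCurve NumberField Literature.NumberTheory.EllipticCurves
  Literature.NumberTheory.EllipticCurves.ModularForms
  Literature.NumberTheory.EllipticCurves.Rank1Residual
  Literature.NumberTheory.EllipticCurves.Rank1Residual.Typed
  IsDedekindDomain Rat.HeightOneSpectrum

/-! ### §1 X4(M) ∧ `r_an = 0`, every odd `p`: OUR `E♭`-level conjecture ⟹ the lower half; `BSD(E,p)` -/

namespace Summit.BirchSwinnertonDyer.Rank1Residual.AdditivePotMult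

open Additive

variable {W : WeierstrassCurve ℚ} [W.IsElliptic] [W.IsGloballyMinimal] {p : ℕ} [hp : Fact p.Prime]

/-- **X4(M) ∧ `r_an = 0`, EVERY odd `p` (`p = 3` included): OUR Λ-adic conjecture on the quadratic
branch of the `p`-multiplicative twist `E♭` ⟹ `Typed.MissingLowerBoundAt W p`** — if
`QuadraticBranchLowerDivisibilityAt V p` holds for every globally minimal twist model `V` with
`C • V^{(p*)} = W`, then `ord_p #Ш_an(E) ≤ ord_p #Ш(E)`. Chain: seat p10's descent to the `T = 0`
branch input of the parity of `(p−1)/2` (`chiBranchLowerLeadingTerm[Odd]At_of_quadraticBranchLower`,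
multiplicative constant terms `±∑(a/p)[a/p]^±`), then this seat's transport to Miller's currency
(`ClassX4M.missingLowerBoundAt_rankZero_of_chiBranchLower[Odd]`: Birch + Pal `hPal` on the even
branch, Pal for `d < 0` proved on the odd one; n1011-p18's consumer over the exact Delbourgo 1998
Prop. 4 (M) `hDelX`; GZK; modularity). The parity split is discharged here (`p ≠ 2` is in `ClassX4`).
NO image, Tamagawa, Manin or certificate hypothesis; N10 stays CONSTRUCTION-SHAPED; nothing booked.
[cite: Delbourgo1998, Prop. 4 (p. 144), §2.2 Lemma (ii) (p. 139), Main Conjecture (p. 151) (shape)]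
[cite: Pal2012, Thm. 3.2] [cite: MazurTateTeitelbaum1986Invent, §I.10, §I.13–I.14]
[cite: SkinnerUrban2014, Thm. 3.6.4 (p. 43) (shape only; nothing asserted)] -/
theorem ClassX4M.missingLowerBoundAt_rankZero_of_quadraticBranchLower
    (hDelX : Delbourgo1998.prop4_rankZero_constantCoeff_eq_unit_mul_of_potMult)
    (hPal : Pal2012.thm32_sqrt_mul_realPeriodRat_twist_eq_of_prime_one_mod_four)
    (hGZK : rank_eq_analyticRank_of_analyticRank_le_one) (hmod : hasEntireLFunction_rat)
    (hmodD : nonempty_modularParametrizationData)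
    (hX : ClassX4M W p) (hr : W.analyticRank = 0)
    (hc : ∀ (V : WeierstrassCurve ℚ) [V.IsElliptic] [V.IsGloballyMinimal],
      (∃ C : VariableChange ℚ, C • V.quadraticTwist ((-1) ^ (p / 2) * p : ℚ) = W) →
        QuadraticBranchLowerDivisibilityAt V p) :
    MissingLowerBoundAt W p := by
  obtain ⟨k, hk⟩ : Odd p := hp.out.odd_of_ne_two hX.classX4.1
  rcases (show p % 4 = 1 ∨ p % 4 = 3 by omega) with hp4 | hp4
  · exact ClassX4M.missingLowerBoundAt_rankZero_of_chiBranchLower hDelX hPal hGZK hmod hmodD hX hp4 hr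
      (chiBranchLowerLeadingTermAt_of_quadraticBranchLower W p hc)
  · exact ClassX4M.missingLowerBoundAt_rankZero_of_chiBranchLowerOdd hDelX hGZK hmod hmodD hX hp4 hr
      (chiBranchLowerLeadingTermOddAt_of_quadraticBranchLower W p hc)

/-- **X4(M) ∧ surj(p) ∧ `r_an = 0`, EVERY odd `p`: OUR `E♭`-level conjecture ⟹ `Typed.X4.MissingInputAt W p`**
— the whole `p`-part input of X4♯ on the pair — the UPPER half being the printed chain read on the
`ω^{(p−1)/2}`-component WITHOUT the Wuthrich-Lemma-20 binder (n1011-p14's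
`ClassX4M.missingInputAt_iff_lower_rankZero_of_surj_noL20`: Kato `hKato`, Delbourgo 1998 Prop. 4
`hDel`, parametrisation data `hmodD`, GZK, modularity). So on X4(M) ∧ surj ∧ `r = 0` what remains of
X4♯ is implied by ONE Λ-adic statement about `E♭`. Nothing booked.
[cite: Kato2004Asterisque, Thm. 17.4 (3) (p. 273)] [cite: Wuthrich2014, Cor. 19 (p. 398)]
[cite: Delbourgo1998, Prop. 4 (p. 144), §2.2 Lemma (ii) (p. 139)] [cite: Pal2012, Thm. 3.2] -/
theorem ClassX4M.x4MissingInputAt_rankZero_of_surj_of_quadraticBranchLower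
    (hDel : Delbourgo1998.prop4_rankZero_pow_dvd_constantCoeff)
    (hDelX : Delbourgo1998.prop4_rankZero_constantCoeff_eq_unit_mul_of_potMult)
    (hPal : Pal2012.thm32_sqrt_mul_realPeriodRat_twist_eq_of_prime_one_mod_four)
    (hGZK : rank_eq_analyticRank_of_analyticRank_le_one) (hmod : hasEntireLFunction_rat)
    (hmodD : nonempty_modularParametrizationData)
    (hKato : Wuthrich2014.kato_halfEigenCharIdeal_dvd_cyclotomicPrime_of_surjective)
    (hX : ClassX4M W p) (hr : W.analyticRank = 0) (hsurj : Surj W p)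
    (hc : ∀ (V : WeierstrassCurve ℚ) [V.IsElliptic] [V.IsGloballyMinimal],
      (∃ C : VariableChange ℚ, C • V.quadraticTwist ((-1) ^ (p / 2) * p : ℚ) = W) →
        QuadraticBranchLowerDivisibilityAt V p) :
    X4.MissingInputAt W p :=
  (ClassX4M.missingInputAt_iff_lower_rankZero_of_surj_noL20 hDel hGZK hmod hmodD hKato hX hr hsurj).mpr
    (ClassX4M.missingLowerBoundAt_rankZero_of_quadraticBranchLower hDelX hPal hGZK hmod hmodD hX hr hc)

/-- **X4(M) ∧ surj(p) ∧ `r_an = 0`, EVERY odd `p` (`p = 3` included): `BSD(E,p)` ⟸ OUR `E♭`-level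
conjecture**, the upper half being n1011-p14's `hL20`-free chain
(`ClassX4M.bsdp_rankZero_of_surj_of_lower_noL20`). On the (M) rows of N10 / N11 the ONE missing
input is the Skinner–Urban direction of the main conjecture of the `p`-MULTIPLICATIVE curve `E♭` on
the `ω^{(p−1)/2}`-component over `ℚ(μ_{p^∞})` — and nothing else. X4(M) stays CONSTRUCTION-SHAPED;
nothing booked. [cite: Kato2004Asterisque, Thm. 17.4 (3) (p. 273)] [cite: Delbourgo1998, Prop. 4 (p. 144)]
[cite: Pal2012, Thm. 3.2] [cite: Miller2011LMS, §1 and Def. 1.1] -/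
theorem ClassX4M.bsdp_rankZero_of_surj_of_quadraticBranchLower
    (hDel : Delbourgo1998.prop4_rankZero_pow_dvd_constantCoeff)
    (hDelX : Delbourgo1998.prop4_rankZero_constantCoeff_eq_unit_mul_of_potMult)
    (hPal : Pal2012.thm32_sqrt_mul_realPeriodRat_twist_eq_of_prime_one_mod_four)
    (hGZK : rank_eq_analyticRank_of_analyticRank_le_one) (hmod : hasEntireLFunction_rat)
    (hmodD : nonempty_modularParametrizationData)
    (hKato : Wuthrich2014.kato_halfEigenCharIdeal_dvd_cyclotomicPrime_of_surjective)
    (hX : ClassX4M W p) (hr : W.analyticRank = 0) (hsurj : Surj W p)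
    (hc : ∀ (V : WeierstrassCurve ℚ) [V.IsElliptic] [V.IsGloballyMinimal],
      (∃ C : VariableChange ℚ, C • V.quadraticTwist ((-1) ^ (p / 2) * p : ℚ) = W) →
        QuadraticBranchLowerDivisibilityAt V p) :
    BSDp W p :=
  ClassX4M.bsdp_rankZero_of_surj_of_lower_noL20 hDel hGZK hmod hmodD hKato hX hr hsurj
    (ClassX4M.missingLowerBoundAt_rankZero_of_quadraticBranchLower hDelX hPal hGZK hmod hmodD hX hr hc)

end Summit.BirchSwinnertonDyer.Rank1Residual.AdditivePotMult

/-! ### §2 X4♯(G-ord) ∩ `I₀*` ∧ `r_an = 0`, every odd `p`, given the exact leading term -/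

namespace Summit.BirchSwinnertonDyer.Rank1Residual.Additive

open AdditivePotMult

variable {W : WeierstrassCurve ℚ} [W.IsElliptic] [W.IsGloballyMinimal] {p : ℕ} [hp : Fact p.Prime]

/-- **X4♯(G-ord) ∩ `I₀*` (`e = 2`) ∧ `r_an = 0`, EVERY odd `p`: OUR `E♭`-level conjecture on the
quadratic branch of the GOOD ORDINARY twist `E♭` + the exact algebraic leading term
`ExactLeadingTermAt W p` ⟹ `Typed.MissingLowerBoundAt W p`.** Chain: p10's descent (good ordinary
constant terms `α⁻¹∑(a/p)[a/p]^±`), this seat's `ClassX4Gord.missingLowerBoundAt_rankZero_of_chiBranchLower[Odd]_of_exact`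
(Birch + Pal; n1011-p18's `_of_exact` consumer); parity discharged (`p ≠ 2` is in `ClassX4`).
[cite: Delbourgo1998, Prop. 4 (p. 144), Main Conjecture (p. 151) (shapes)] [cite: Pal2012, Thm. 3.2]
[cite: MazurTateTeitelbaum1986Invent, §I.13–I.14] -/
theorem ClassX4Gord.missingLowerBoundAt_rankZero_of_quadraticBranchLower_of_exact
    (hPal : Pal2012.thm32_sqrt_mul_realPeriodRat_twist_eq_of_prime_one_mod_four)
    (hGZK : rank_eq_analyticRank_of_analyticRank_le_one) (hmod : hasEntireLFunction_rat)
    (hmodD : nonempty_modularParametrizationData)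
    (hX : ClassX4Gord W p) (he : semistabilityIndex W p = 2) (hr : W.analyticRank = 0)
    (hEx : ExactLeadingTermAt W p)
    (hc : ∀ (V : WeierstrassCurve ℚ) [V.IsElliptic] [V.IsGloballyMinimal],
      (∃ C : VariableChange ℚ, C • V.quadraticTwist ((-1) ^ (p / 2) * p : ℚ) = W) →
        QuadraticBranchLowerDivisibilityAt V p) :
    MissingLowerBoundAt W p := by
  obtain ⟨k, hk⟩ : Odd p := hp.out.odd_of_ne_two hX.addv.1
  rcases (show p % 4 = 1 ∨ p % 4 = 3 by omega) with hp4 | hp4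
  · exact ClassX4Gord.missingLowerBoundAt_rankZero_of_chiBranchLower_of_exact hPal hGZK hmod hmodD hX he
      hp4 hr (chiBranchLowerLeadingTermAt_of_quadraticBranchLower W p hc) hEx
  · exact ClassX4Gord.missingLowerBoundAt_rankZero_of_chiBranchLowerOdd_of_exact hGZK hmod hmodD hX he
      hp4 hr (chiBranchLowerLeadingTermOddAt_of_quadraticBranchLower W p hc) hEx

/-- **X4♯(G-ord) ∩ `I₀*` ∧ surj(p) ∧ `r_an = 0`, EVERY odd `p`: OUR conjecture + `ExactLeadingTermAt W p`
⟹ `Typed.X4.MissingInputAt W p`**, the upper half being Kato's divisibility read on the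
`ω^{(p−1)/2}`-component of `E♭` (`hK`, Delbourgo Prop. 4 `hDel`) with the tower from surj(p) alone
(n1011-p14, `ClassX4Gord.missingInputAt_iff_lower_rankZero_of_katoComponent_of_surj`).
[cite: Kato2004Asterisque, Thm. 17.4 (3) (p. 273)] [cite: Delbourgo1998, Prop. 4 (p. 144)] [cite: Pal2012, Thm. 3.2] -/
theorem ClassX4Gord.x4MissingInputAt_rankZero_of_surj_of_quadraticBranchLower_of_exact
    (hK : Kato2004.charIdeal_dvd_padicLFunctionBranch_component_of_surjective)
    (hDel : Delbourgo1998.prop4_rankZero_pow_dvd_constantCoeff)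
    (hPal : Pal2012.thm32_sqrt_mul_realPeriodRat_twist_eq_of_prime_one_mod_four)
    (hGZK : rank_eq_analyticRank_of_analyticRank_le_one) (hmod : hasEntireLFunction_rat)
    (hmodD : nonempty_modularParametrizationData)
    (hX : ClassX4Gord W p) (he : semistabilityIndex W p = 2) (hr : W.analyticRank = 0)
    (hsurj : Surj W p) (hEx : ExactLeadingTermAt W p)
    (hc : ∀ (V : WeierstrassCurve ℚ) [V.IsElliptic] [V.IsGloballyMinimal],
      (∃ C : VariableChange ℚ, C • V.quadraticTwist ((-1) ^ (p / 2) * p : ℚ) = W) →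
        QuadraticBranchLowerDivisibilityAt V p) :
    X4.MissingInputAt W p :=
  (ClassX4Gord.missingInputAt_iff_lower_rankZero_of_katoComponent_of_surj hK hDel hGZK hmod hmodD hX he
      hr hsurj).mpr
    (ClassX4Gord.missingLowerBoundAt_rankZero_of_quadraticBranchLower_of_exact hPal hGZK hmod hmodD hX he
      hr hEx hc)

/-- **X4♯(G-ord) ∩ `I₀*` ∧ surj(p) ∧ `r_an = 0`, EVERY odd `p` (`p = 3` included): `BSD(E,p)` ⟸ OUR
conjecture + `ExactLeadingTermAt W p`** (upper half: `ClassX4Gord.bsdp_rankZero_of_katoComponent_of_surj_of_lower`,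
certificate-free). X4♯(G-ord) stays CONSTRUCTION-SHAPED; nothing booked.
[cite: Kato2004Asterisque, Thm. 17.4 (3) (p. 273)] [cite: Delbourgo1998, Prop. 4 (p. 144)]
[cite: Pal2012, Thm. 3.2] [cite: Miller2011LMS, §1 and Def. 1.1] -/
theorem ClassX4Gord.bsdp_rankZero_of_surj_of_quadraticBranchLower_of_exact
    (hK : Kato2004.charIdeal_dvd_padicLFunctionBranch_component_of_surjective)
    (hDel : Delbourgo1998.prop4_rankZero_pow_dvd_constantCoeff)
    (hPal : Pal2012.thm32_sqrt_mul_realPeriodRat_twist_eq_of_prime_one_mod_four)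
    (hGZK : rank_eq_analyticRank_of_analyticRank_le_one) (hmod : hasEntireLFunction_rat)
    (hmodD : nonempty_modularParametrizationData)
    (hX : ClassX4Gord W p) (he : semistabilityIndex W p = 2) (hr : W.analyticRank = 0)
    (hsurj : Surj W p) (hEx : ExactLeadingTermAt W p)
    (hc : ∀ (V : WeierstrassCurve ℚ) [V.IsElliptic] [V.IsGloballyMinimal],
      (∃ C : VariableChange ℚ, C • V.quadraticTwist ((-1) ^ (p / 2) * p : ℚ) = W) →
        QuadraticBranchLowerDivisibilityAt V p) :
    BSDp W p :=
  ClassX4Gord.bsdp_rankZero_of_katoComponent_of_surj_of_lower hK hDel hGZK hmod hmodD hX he hr hsurj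
    (ClassX4Gord.missingLowerBoundAt_rankZero_of_quadraticBranchLower_of_exact hPal hGZK hmod hmodD hX he
      hr hEx hc)

/-! ### §3 (G-ord)@3 — `p = 3`, defect `2` automatic: the exact input replaced by Delbourgo 2002 at `3` -/

/-- **(G-ord)@3, rank `0`: OUR conjecture at `p = 3` ⟹ the decl of record `CycLowerLeadingTermAt W 3`**
(the cyclotomic `T = 0` lower input; on an additive (G)-ordinary pair at `3` the defect is `2`
automatically, `semistabilityIndex_eq_two_of_typeG_three`; twist by `−3`, odd branch, Pal `d < 0`
proved; `TypeGOrd.…` bridge of this seat's `ChiBranchLowerTransport.lean`). The twist hypothesis is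
spelled with the literal `-3`. [cite: Pal2012, Thm. 3.2] [cite: MazurTateTeitelbaum1986Invent, §I.13–I.14]
[cite: Delbourgo1998, Main Conjecture (p. 151) (shape only; nothing asserted)] -/
theorem TypeGOrd.cycLowerLeadingTermAt_three_of_quadraticBranchLower
    (hmod : hasEntireLFunction_rat) (hmodD : nonempty_modularParametrizationData)
    (hG : TypeGOrd W 3) (hadd : Addv W 3)
    (hc : ∀ (V : WeierstrassCurve ℚ) [V.IsElliptic] [V.IsGloballyMinimal],
      (∃ C : VariableChange ℚ, C • V.quadraticTwist (-3 : ℚ) = W) →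
        QuadraticBranchLowerDivisibilityAt V 3) :
    CycLowerLeadingTermAt W 3 := by
  have h3 : ((-1 : ℚ) ^ (3 / 2) * ((3 : ℕ) : ℚ)) = -3 := by norm_num
  have hLow : ChiBranchLowerLeadingTermOddAt W 3 :=
    chiBranchLowerLeadingTermOddAt_of_quadraticBranchLower W 3 fun V _ _ hCW ↦ hc V (by
      obtain ⟨C, hC⟩ := hCW
      exact ⟨C, by rwa [h3] at hC⟩)
  exact (cycLowerLeadingTermAt_iff_chiBranchLowerOdd_of_typeGOrd_of_semistabilityIndex_eq_two W 3 hmod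
    hmodD (by norm_num) hadd hG (semistabilityIndex_eq_two_of_typeG_three W hG.typeG hadd)).mpr hLow

/-- **X4♯(G-ord) at `3`, rank `0`, non-CM, OFF the anomalous rows: OUR conjecture at `p = 3` ⟹
`Typed.MissingLowerBoundAt W 3`** — the exact-leading-term input of §2 REPLACED by Delbourgo 2002 at
`3` (`hDel3`, n1011-p16's `ClassX4Gord.missingLowerBoundAt_three_rankZero_of_cycLower_of_nonAnomalous`:
(A) torsion, (B) leading-term clauses, `ℓ₃ = 1` off the anomalous rows). Inputs: `hDel3`, GZK,
modularity, parametrisation data; NO image / certificate / Tamagawa / Manin hypothesis.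
[cite: Delbourgo2002, Theorem (A), (B) (p. 40), Hypothesis (p. 39)] [cite: Pal2012, Thm. 3.2]
[cite: Miller2011LMS, Def. 1.1] -/
theorem ClassX4Gord.missingLowerBoundAt_three_rankZero_of_quadraticBranchLower_of_nonAnomalous
    (hDel3 : Delbourgo2002.mainTheorem_three)
    (hGZK : rank_eq_analyticRank_of_analyticRank_le_one) (hmod : hasEntireLFunction_rat)
    (hmodD : nonempty_modularParametrizationData)
    (hX : ClassX4Gord W 3) (hcm : ¬ W.HasCM) (hr : W.analyticRank = 0)
    (hna : Delbourgo2002.ReductionNonAnomalous W 3)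
    (hc : ∀ (V : WeierstrassCurve ℚ) [V.IsElliptic] [V.IsGloballyMinimal],
      (∃ C : VariableChange ℚ, C • V.quadraticTwist (-3 : ℚ) = W) →
        QuadraticBranchLowerDivisibilityAt V 3) :
    MissingLowerBoundAt W 3 :=
  ClassX4Gord.missingLowerBoundAt_three_rankZero_of_cycLower_of_nonAnomalous hDel3 hGZK hmod hX hcm hr hna
    (hX.typeGOrd.cycLowerLeadingTermAt_three_of_quadraticBranchLower hmod hmodD hX.addv.2 hc)

/-- **X4♯(G-ord) at `3` ∧ surj(3), rank `0`, non-CM, non-anomalous: `BSD(E,3)` ⟸ OUR conjecture at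
`p = 3` ALONE among unproved inputs** — upper half = additive-p2's `ω`-branch chain with n1011-p14's
certificate-free tower (Kato `hK`, Delbourgo 1998 Prop. 4 `hDel`), lower half = §3 over Delbourgo 2002
at `3` (`hDel3`); n1011-p16's `ClassX4Gord.bsdp_three_rankZero_of_cycLower_of_nonAnomalous_of_surj`.
On the non-anomalous non-CM (G-ord)@3 share of N11 the missing input is the Skinner–Urban direction
on the `ω`-component of the good ordinary twist `E♭` over `ℚ(μ_{3^∞})`, and NOTHING ELSE. Nothing booked.
[cite: Delbourgo2002, Theorem (A), (B) (p. 40)] [cite: Kato2004Asterisque, Thm. 17.4 (3) (p. 273)]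
[cite: Delbourgo1998, Prop. 4 (p. 144)] [cite: Miller2011LMS, §1 and Def. 1.1] -/
theorem ClassX4Gord.bsdp_three_rankZero_of_surj_of_quadraticBranchLower_of_nonAnomalous
    (hDel3 : Delbourgo2002.mainTheorem_three)
    (hK : Kato2004.charIdeal_dvd_padicLFunctionBranch_component_of_surjective)
    (hDel : Delbourgo1998.prop4_rankZero_pow_dvd_constantCoeff)
    (hGZK : rank_eq_analyticRank_of_analyticRank_le_one) (hmod : hasEntireLFunction_rat)
    (hmodD : nonempty_modularParametrizationData)
    (hX : ClassX4Gord W 3) (hcm : ¬ W.HasCM) (hr : W.analyticRank = 0) (hsurj : Surj W 3)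
    (hna : Delbourgo2002.ReductionNonAnomalous W 3)
    (hc : ∀ (V : WeierstrassCurve ℚ) [V.IsElliptic] [V.IsGloballyMinimal],
      (∃ C : VariableChange ℚ, C • V.quadraticTwist (-3 : ℚ) = W) →
        QuadraticBranchLowerDivisibilityAt V 3) :
    BSDp W 3 :=
  ClassX4Gord.bsdp_three_rankZero_of_cycLower_of_nonAnomalous_of_surj hDel3 hK hDel hGZK hmod hmodD hX
    hcm hr hsurj hna (hX.typeGOrd.cycLowerLeadingTermAt_three_of_quadraticBranchLower hmod hmodD hX.addv.2 hc)

/-- **X4♯(G-ord) at `3`, rank `0`, non-CM, EVERY row (anomalous included): OUR conjecture at `p = 3`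
⟹ `#Ш_an(E) = q` with `ord₃ q ≤ ord₃ #Ш(E) + 2`** — the slack `ℓ₃ ∣ 9` of Delbourgo 2002 (B) on
the anomalous rows (n1011-p16's `TypeGOrd.padicValRat_shaAn_le_add_two_three_of_cycLower`).
[cite: Delbourgo2002, Theorem (A), (B) (p. 40), ℓ_p(E) (p. 39)] -/
theorem ClassX4Gord.padicValRat_shaAn_le_add_two_three_of_quadraticBranchLower
    (hDel3 : Delbourgo2002.mainTheorem_three)
    (hGZK : rank_eq_analyticRank_of_analyticRank_le_one) (hmod : hasEntireLFunction_rat)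
    (hmodD : nonempty_modularParametrizationData)
    (hX : ClassX4Gord W 3) (hcm : ¬ W.HasCM) (hr : W.analyticRank = 0)
    (hc : ∀ (V : WeierstrassCurve ℚ) [V.IsElliptic] [V.IsGloballyMinimal],
      (∃ C : VariableChange ℚ, C • V.quadraticTwist (-3 : ℚ) = W) →
        QuadraticBranchLowerDivisibilityAt V 3) :
    ∃ q : ℚ, shaAn W = (q : ℂ) ∧ padicValRat 3 q ≤ padicValNat 3 W.shaOrder + 2 :=
  hX.typeGOrd.padicValRat_shaAn_le_add_two_three_of_cycLower hDel3 hGZK hmod hX.addv.2 hcm hr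
    (hX.typeGOrd.cycLowerLeadingTermAt_three_of_quadraticBranchLower hmod hmodD hX.addv.2 hc)

end Summit.BirchSwinnertonDyer.Rank1Residual.Additive

end
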